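import Summits.BirchSwinnertonDyer.BirchSwinnertonDyer.Theorems.ErratumRoadFiveNonSurjCornerBranchesAn
import HarnessLib

/-!
# Route `ErratumRoadFive` (rung K2, `p ≥ 5`): the GLUE ITEM of the split of crux 6 `NonSurjCorner`
# (item stmt-BirchSwinnertonDyer-19951 `NonSurjCornerGlue`, planner g30 edit «CORNER», rev 21)

`NonSurjCornerGlue : NonSurjCornerKolyZ → NonSurjCornerKolyJ → NonSurjCornerTwinMuAn → KatoTwinFactsFiveAn →
NonSurjCornerLowerX11a → NonSurjCorner` (route-file decls; the three crux children are the Theorems constants of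
`ErratumRoadFiveNonSurjCornerBranchesDefs.lean` BY NAME, the bundle is the 23-fact conjunction, the fifth child is the
by-name alias of crux 19064 `X11aLowerHalf`) holds by corner-p1 g6's (landed by g7) `Theorems.nonSurjCorner_of_branchesAn`
(`ErratumRoadFiveNonSurjCornerBranchesAn.lean`), definitionally. Pure glue; CONDITIONAL content lives in the children;
nothing is asserted about any curve; BSD is not advanced (T7).
-/

set_option autoImplicit false
set_option linter.dupNamespace false

namespace Summit.BirchSwinnertonDyer.BirchSwinnertonDyer.Theorems

/-- The split glue of crux 6 `NonSurjCorner` (item 19951) — one line over `nonSurjCorner_of_branchesAn`. -/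
theorem nonSurjCornerGlue_holds :
    Summit.BirchSwinnertonDyer.BirchSwinnertonDyer.Theses.ErratumRoadFive.NonSurjCornerGlue :=
  fun hZ hJ hμ hF h₄ ↦ nonSurjCorner_of_branchesAn hZ hJ hμ hF h₄

end Summit.BirchSwinnertonDyer.BirchSwinnertonDyer.Theorems
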